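import Literature.Analysis.FluidPDE.NSVorticityBKMHolds
import HarnessLib

/-!
# Fluid computer — the VORTICITY OCCUPATION of a blow-up diverges inside every terminal window (ν ≥ 0: Euler included)

HONEST FRAMING (cell `pub-fluidc`, verbatim): *low prior, high value-of-information experiment on Tao's
machine paradigm; NOT a claim that NS blows up.* Theorem side of the cell; nothing here is evidence of blow-up.

HOME/PLAN.md §0 records the EULER CAVEAT of the amplitude rung: for `ν = 0` the level-Reynolds floor is void and
only a Beale–Kato–Majda-type necessity survives. This file types that necessity in the cell's CLOCK/OCCUPATION
currency (RULING R35 F6: occupation `O = k · U · τ`, wavenumber × amplitude × residence; the vorticity sup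
`‖ω(t)‖_∞` is the field's own "wavenumber × amplitude"), uniformly for `ν ≥ 0`, from the tree's DISCHARGED
Beale–Kato–Majda theorem (`Literature.Analysis.FluidPDE.beale_kato_majda_holds`; blow-up form
`lintegral_iSup_curl_eq_top_of_not_hasSobolevExtensionPast_holds`, Beale–Kato–Majda 1984 Thm. 1 /
Majda–Bertozzi 2002 Thm. 3.6):

* `lintegral_iSup_curl_window_eq_top` — a classical solution on `ℝ³ × [0, T)` (`ν ≥ 0`) in the BKM class (all `L²`
  Sobolev norms bounded on every `[0, T'']`, `T'' < T`) which does NOT continue in the class past `T` has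
  `∫_{(t₀,T)} ‖curl u(t)‖_{L^∞} dt = ∞` for EVERY `t₀ ∈ [0, T)` — the vorticity occupation is delivered arbitrarily
  late (the early part `∫_{(0,t₀]}` is finite by the Sobolev imbedding bound
  `exists_enorm_curl_le_of_hasBoundedSobolevNormsOn` on `[0, t₀]`);
* `lintegral_iSup_curl_window_eq_top_of_maximal` — the same for the cell's maximal smooth solutions
  (`IsMaximalSmoothSolution ν 0 u p T`: no classical extension, hence no extension in the class,
  `HasSobolevExtensionPast.hasSmoothExtensionPast`), `ν ≥ 0`.

In cascade words (hedged dictionary, not a theorem about bands): `‖ω‖_∞ ≲ Σ_n k_n U_n` over the active levels, so a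
cascade whose summed occupation `Σ_n k_n U_n T_n` stays finite in some terminal window is not a blow-up — for Euler
as for Navier–Stokes; the viscous theory adds the PER-LEVEL floors (`LevelReynoldsFloor`, `LevelOccupationFloor`,
`OccupationRestartFloor`).

0 sorry; no new definitions or named facts (inputs: the discharged BKM theorem and the tree's Sobolev imbedding).

## References

* J. T. Beale, T. Kato, A. Majda, Comm. Math. Phys. 94 (1984) 61–66, Thm. 1. [BealeKatoMajda1984]
* A. J. Majda, A. L. Bertozzi, *Vorticity and Incompressible Flow*, CUP 2002, Thm. 3.6, Cor. 3.2. [MajdaBertozzi2002]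
-/

noncomputable section

open MeasureTheory Set Function Filter Topology
open scoped ENNReal NNReal
open Literature.Analysis.FluidPDE

namespace Summit.NavierStokesRegularity.FluidComputer.VorticityOccupationWindow

/-- **The vorticity occupation diverges inside every terminal window** (`ν ≥ 0`). Let `(u, p)` be a classical
solution of the unforced Navier–Stokes (`ν > 0`) or Euler (`ν = 0`) system on `ℝ³ × [0, T)`, `T > 0`, lying in the
Beale–Kato–Majda class on every compact sub-interval (`HasBoundedSobolevNormsOn (Icc 0 T'') u` for `T'' < T`) and
NOT continuing in that class past `T`. Then for every `t₀ ∈ [0, T)`: `∫_{(t₀, T)} sup_x ‖curl u(t, x)‖ dt = ∞`.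
Proof: the whole-interval form is the tree's discharged BKM blow-up theorem; on `(0, t₀]` the integrand is bounded
by a finite `R` (Sobolev imbedding on the BKM class over `[0, t₀]`), so that part is finite and the divergence
sits in `(t₀, T)`. [cite: BealeKatoMajda1984, Theorem 1] -/
theorem lintegral_iSup_curl_window_eq_top {ν : ℝ} (hν : 0 ≤ ν) {T : ℝ} (hT : 0 < T)
    {u : ℝ → EuclideanSpace ℝ (Fin 3) → EuclideanSpace ℝ (Fin 3)} {p : ℝ → EuclideanSpace ℝ (Fin 3) → ℝ}
    (hsol : IsClassicalNSSolutionOn (Ico 0 T) ν 0 u p)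
    (hreg : ∀ T'' < T, HasBoundedSobolevNormsOn (Icc 0 T'') u)
    (hmax : ¬ HasSobolevExtensionPast ν u T) {t₀ : ℝ} (ht₀ : t₀ ∈ Ico 0 T) :
    (∫⁻ t in Ioo t₀ T, ⨆ x, ‖curl (u t) x‖ₑ) = ∞ := by
  have htot : (∫⁻ t in Ioo 0 T, ⨆ x, ‖curl (u t) x‖ₑ) = ∞ :=
    lintegral_iSup_curl_eq_top_of_not_hasSobolevExtensionPast_holds hν hT hsol hreg hmax
  -- the early part `(0, t₀]` is finite: `‖curl u‖ ≤ R` on `[0, t₀] × ℝ³`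
  have hsm : ∀ t ∈ Icc 0 t₀, ContDiff ℝ ((⊤ : ℕ∞) : WithTop ℕ∞) (u t) := fun t ht =>
    hsol.contDiff_velocity ⟨ht.1, ht.2.trans_lt ht₀.2⟩
  obtain ⟨R, hRtop, hR⟩ := exists_enorm_curl_le_of_hasBoundedSobolevNormsOn hsm (hreg t₀ ht₀.2)
  have hearly : (∫⁻ t in Ioc 0 t₀, ⨆ x, ‖curl (u t) x‖ₑ) < ∞ := by
    have hle : (∫⁻ t in Ioc 0 t₀, ⨆ x, ‖curl (u t) x‖ₑ) ≤ ∫⁻ _ in Ioc (0 : ℝ) t₀, R :=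
      setLIntegral_mono' measurableSet_Ioc fun t ht => iSup_le fun x => hR t ⟨ht.1.le, ht.2⟩ x
    refine hle.trans_lt ?_
    rw [setLIntegral_const, Real.volume_Ioc]
    exact ENNReal.mul_lt_top hRtop ENNReal.ofReal_lt_top
  -- split `(0, T) ⊆ (0, t₀] ∪ (t₀, T)`
  by_contra hne
  have hlate : (∫⁻ t in Ioo t₀ T, ⨆ x, ‖curl (u t) x‖ₑ) < ∞ := lt_top_iff_ne_top.2 hne
  have hsplit : (∫⁻ t in Ioo 0 T, ⨆ x, ‖curl (u t) x‖ₑ) ≤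
      (∫⁻ t in Ioc 0 t₀, ⨆ x, ‖curl (u t) x‖ₑ) + ∫⁻ t in Ioo t₀ T, ⨆ x, ‖curl (u t) x‖ₑ :=
    calc (∫⁻ t in Ioo 0 T, ⨆ x, ‖curl (u t) x‖ₑ)
        ≤ ∫⁻ t in Ioc 0 t₀ ∪ Ioo t₀ T, ⨆ x, ‖curl (u t) x‖ₑ :=
          lintegral_mono_set fun t ht => by
            rcases le_or_gt t t₀ with h | h
            · exact Or.inl ⟨ht.1, h⟩
            · exact Or.inr ⟨h, ht.2⟩
      _ ≤ _ := lintegral_union_le _ _ _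
  have hlt : (∫⁻ t in Ioo 0 T, ⨆ x, ‖curl (u t) x‖ₑ) < ∞ := hsplit.trans_lt (ENNReal.add_lt_top.2 ⟨hearly, hlate⟩)
  exact hlt.ne htot

/-- **The same for the cell's maximal smooth solutions** (`IsMaximalSmoothSolution ν 0 u p T`: classical on
`[0, T)`, no classical extension past `T`), `ν ≥ 0`, in the BKM class on compact sub-intervals: the vorticity
occupation `∫_{(t₀,T)} ‖curl u(t)‖_∞ dt` is infinite in EVERY terminal window. (A classical extension would in
particular be an extension in the class: `HasSobolevExtensionPast.hasSmoothExtensionPast`.) For `ν = 0` this is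
the theorem-side content of the rung's EULER CAVEAT (HOME/PLAN.md §0) in occupation currency.
[cite: BealeKatoMajda1984, Theorem 1] -/
theorem lintegral_iSup_curl_window_eq_top_of_maximal {ν : ℝ} (hν : 0 ≤ ν) {T : ℝ} (hT : 0 < T)
    {u : ℝ → EuclideanSpace ℝ (Fin 3) → EuclideanSpace ℝ (Fin 3)} {p : ℝ → EuclideanSpace ℝ (Fin 3) → ℝ}
    (hmax : IsMaximalSmoothSolution ν 0 u p T)
    (hreg : ∀ T'' < T, HasBoundedSobolevNormsOn (Icc 0 T'') u) {t₀ : ℝ} (ht₀ : t₀ ∈ Ico 0 T) :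
    (∫⁻ t in Ioo t₀ T, ⨆ x, ‖curl (u t) x‖ₑ) = ∞ :=
  lintegral_iSup_curl_window_eq_top hν hT hmax.1 hreg
    (fun hext => hmax.2 hext.hasSmoothExtensionPast) ht₀

end Summit.NavierStokesRegularity.FluidComputer.VorticityOccupationWindow

end
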